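import Summits.Parity.GeneralizedHardyLittlewood.Theses.GreenTaoLevelTwo
import Literature.NumberTheory.Sieve.LinearEquationsInPrimesHeisenbergBoxMetric
import HarnessLib

/-!
# Route `GreenTaoLevelTwo` — support item `HeisMetricExists` (stmt-Parity-21278)

The by-name closing file: the route item `HeisMetricExists` is by definition the Literature statement
`Literature.NumberTheory.Sieve.GreenTaoLevelTwo.HeisMetricExists` (an explicit metric on `H³(ℝ)/H³(ℤ)` with
the axioms of Green–Tao 2010 Def. 8.1, bi-Lipschitz comparable to the box pre-distance `ρ₀`), PROVED in the
tree as `Literature.NumberTheory.Sieve.GreenTaoLevelTwo.HeisMetricExists_holds` (file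
`Literature/NumberTheory/Sieve/LinearEquationsInPrimesHeisenbergBoxMetric.lean`: the chain metric generated by
`ρ₀`, Green–Tao 2012b Def. 2.2 / App. A, with `ρ₀/3 ≤ d ≤ ρ₀`).  Honesty label (ROUND-6 §0): formalisation-first;
FRONTIER rung F-GT2; no summit motion.
-/

namespace Summit.Parity.GeneralizedHardyLittlewood.Theorems

/-- **`HeisMetricExists` holds** (route `GreenTaoLevelTwo`, support stmt-Parity-21278): there is a Def-8.1
metric on the Heisenberg nilmanifold `H³(ℝ)/H³(ℤ)` bi-Lipschitz comparable to the box pre-distance `ρ₀`.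
Proof: the Literature theorem `GreenTaoLevelTwo.HeisMetricExists_holds` (the chain metric of `ρ₀`). -/
theorem greenTaoLevelTwo_heisMetricExists_proof :
    Summit.Parity.GeneralizedHardyLittlewood.Theses.GreenTaoLevelTwo.HeisMetricExists := by
  unfold Summit.Parity.GeneralizedHardyLittlewood.Theses.GreenTaoLevelTwo.HeisMetricExists
  exact Literature.NumberTheory.Sieve.GreenTaoLevelTwo.HeisMetricExists_holds

end Summit.Parity.GeneralizedHardyLittlewood.Theorems
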